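import Summits.AtomisticToContinuum.FouriersLaw.Theorems.HonestZwanzigOrthogonalOhmBoundedResponse
import Summits.AtomisticToContinuum.FouriersLaw.Theorems.HonestZwanzigOrthogonalOhmUniformCore

/-!
# OrthogonalOhm — STRATEGY CENSUS r1, typed companion (crux-strategist r1, 2026-08-17)

Crux item `stmt-AtomisticToContinuum-12693` (`HonestZwanzig.OrthogonalOhm`, route `HonestZwanzig`, sub-problem
`FouriersLaw`).  Companion to `Cruxes/OrthogonalOhm/STRATEGY-CENSUS-r1.md` (second-opinion census after s2's).
Everything below is sorry-free; nothing is a registered line.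

* `UniformResponseBound` (piece A, TIGHTNESS) and `BulkHomogeneity` (piece B, IDENTIFICATION) — the
  tightness/identification split of §Decomposition D-r1-1, typed over the crux's byte-identical gadgets;
  `orthogonalOhm_of_pieces : A → B → OrthogonalOhm` (assembly, via the landed `orthogonalOhm_of_uniformResponses`)
  and `pieces_of_orthogonalOhm : OrthogonalOhm → A ∧ B` (the split is EXACT modulo the landed fixed-`N` facts).
* `greenKubo_le_of_tight`, `boundedResponse_of_tight` — **piece A ALONE already implies the shared open item
  `OddSectorIrreversibility.BoundedResponse` (stmt-10924)**, i.e. the catalogued barrier predicate: the split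
  does not distribute the `N`-uniform difficulty, it relabels it (reason D-r1-1 is not filed).
* `SchurStieltjesMonotone` (S-r1-1), `UniformGeometricModulus` (S-r1-2), `FiniteWindowOhm` (T-r1-5 / D-r1-3):
  the strengthenings / transferred statement discussed in the census, typed so that they elaborate.
-/

noncomputable section

namespace Summit.AtomisticToContinuum.FouriersLaw.Cruxes.OrthogonalOhm.StrategyCensusR1

open MeasureTheory Filter Topology Set
open Literature.MathematicalPhysics.KineticTheory.HeatConduction
open Summit.AtomisticToContinuum.FouriersLaw.Theses
open Summit.AtomisticToContinuum.FouriersLaw.Theorems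
open Summit.AtomisticToContinuum.FouriersLaw.Theorems.HonestZwanzig
open Summit.AtomisticToContinuum.FouriersLaw.Theorems.HonestZwanzig.NetworkReduction

/-! ### D-r1-1: tightness + identification -/

/-- **Piece A — `UniformResponseBound` (TIGHTNESS).**  One constant `C` bounds, uniformly in `N`, ANY zero-frequency
limit of the orthogonal bond responses `schur_s(j_b, J)` (all bonds) and of the two contact pairings `schur_s(p_y², J)`.
(= the boundedness halves of the lead's U1 and U2.) -/
def UniformResponseBound : Prop :=
  ∀ ω₂ lam β γ : ℝ, 0 < ω₂ → 0 < lam → 0 < β → 0 < γ → ∀ T : ℝ, 0 < T → ∃ C : ℝ, ∀ N : ℕ, 2 ≤ N → let P := Literature.MathematicalPhysics.KineticTheory.HeatConduction.pinnedChain ω₂ lam β γ; let X := Literature.MathematicalPhysics.KineticTheory.HeatConduction.PhaseSpace N; let μ : MeasureTheory.Measure X := P.gibbsMeasure N T; let corr : (X → ℝ) → (X → ℝ) → ℝ → ℝ := fun f g t => (∫ z, f z * (∫ y, g y ∂(P.transitionKernel N T T t.toNNReal z)) ∂μ) - (∫ z, f z ∂μ) * (∫ z, g z ∂μ); let lap :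 ℝ → (X → ℝ) → (X → ℝ) → ℝ := fun s f g => ∫ t in Set.Ioi (0 : ℝ), Real.exp (-(s * t)) * corr f g t; let e : Fin N → X → ℝ := fun x z => z.2 x ^ 2 / 2 + P.U (z.1 x) + ∑ j : Fin N, ((if j.val = x.val + 1 then P.V (z.1 j - z.1 x) / 2 else 0) + (if x.val = j.val + 1 then P.V (z.1 x - z.1 j) / 2 else 0)); let G : ℝ → Matrix (Fin N) (Fin N) ℝ := fun s => Matrix.of fun x y => lap s (e x) (e y); let schur : ℝ → (X → ℝ) → (X → ℝ) → ℝ := fun s f g => lap s f g - ∑ x : Fin N, ∑ y : Fin N, lap s f (e x) * (G s)⁻¹ x y * lap s (e y) g; let J : X → ℝ := fun z => ∑ i : Fin N, P.bondCurrent N i z; (∀ b : Fin N, b.val + 1 < N → ∀ ρ : ℝ, Filter.Tendsto (fun s => schur s (P.bondCurrent N b) J) (nhdsWithin (0 : ℝ) (Set.Ioi 0)) (nhds ρ) → |ρ| ≤ C) ∧ (∀ b : Fin N, (b.val = 0 ∨ b.val = N - 1) → ∀ w : ℝ, Filter.Tendsto (fun s => schur s (fun z => z.2 b ^ 2) J)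 (nhdsWithin (0 : ℝ) (Set.Ioi 0)) (nhds w) → |w| ≤ C)

/-- **Piece B — `BulkHomogeneity` (IDENTIFICATION).**  One constant `k` such that ANY zero-frequency limit of
`schur_s(j_b, J)` is within `ε` of `k` on bonds at distance `≥ R(ε)` from both ends, uniformly in `N`
(= the homogeneity half of U1; no boundedness of boundary bonds or contacts inside). -/
def BulkHomogeneity : Prop :=
  ∀ ω₂ lam β γ : ℝ, 0 < ω₂ → 0 < lam → 0 < β → 0 < γ → ∀ T : ℝ, 0 < T → ∃ k : ℝ, ∀ ε : ℝ, 0 < ε → ∃ R : ℕ, ∀ N : ℕ, 2 ≤ N → let P := Literature.MathematicalPhysics.KineticTheory.HeatConduction.pinnedChain ω₂ lam β γ; let X := Literature.MathematicalPhysics.KineticTheory.HeatConduction.PhaseSpace N; let μ : MeasureTheory.Measure X := P.gibbsMeasure N T; let corr : (X → ℝ) → (X → ℝ) → ℝ → ℝ := fun f g t => (∫ z, f z * (∫ y, g y ∂(P.transitionKernel N T T t.toNNReal z)) ∂μ) - (∫ z, f z ∂μ) * (∫ z, g z ∂μ); let lap : ℝ → (X → ℝ) → (X → ℝ) → ℝ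 := fun s f g => ∫ t in Set.Ioi (0 : ℝ), Real.exp (-(s * t)) * corr f g t; let e : Fin N → X → ℝ := fun x z => z.2 x ^ 2 / 2 + P.U (z.1 x) + ∑ j : Fin N, ((if j.val = x.val + 1 then P.V (z.1 j - z.1 x) / 2 else 0) + (if x.val = j.val + 1 then P.V (z.1 x - z.1 j) / 2 else 0)); let G : ℝ → Matrix (Fin N) (Fin N) ℝ := fun s => Matrix.of fun x y => lap s (e x) (e y); let schur : ℝ → (X → ℝ) → (X → ℝ) → ℝ := fun s f g => lap s f g - ∑ x : Fin N, ∑ y : Fin N, lap s f (e x) * (G s)⁻¹ x y * lap s (e y) g; let J : X → ℝ := fun z => ∑ i : Fin N, P.bondCurrent N i z; ∀ b : Fin N, R ≤ b.val → b.val + 2 + R ≤ N → ∀ ρ : ℝ, Filter.Tendsto (fun s => schur s (P.bondCurrent N b) J) (nhdsWithin (0 : ℝ) (Set.Ioi 0)) (nhds ρ) → |ρ - k| ≤ ε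

/-- A and B give the lead's stub U1 (`stub_uniformBondResponse`, any-limit form) — pure bookkeeping. -/
theorem uniformBond_of_pieces (hA : UniformResponseBound) (hB : BulkHomogeneity) :
    ∀ ω₂ lam β γ : ℝ, 0 < ω₂ → 0 < lam → 0 < β → 0 < γ → ∀ T : ℝ, 0 < T → ∃ k C : ℝ, ∀ ε : ℝ, 0 < ε → ∃ R : ℕ, ∀ N : ℕ, 2 ≤ N → let P := Literature.MathematicalPhysics.KineticTheory.HeatConduction.pinnedChain ω₂ lam β γ; let X := Literature.MathematicalPhysics.KineticTheory.HeatConduction.PhaseSpace N; let μ : MeasureTheory.Measure X := P.gibbsMeasure N T; let corr : (X → ℝ) → (X → ℝ) → ℝ → ℝ := fun f g t => (∫ z, f z * (∫ y, g y ∂(P.transitionKernel N T T t.toNNReal z)) ∂μ) - (∫ z, f z ∂μ) * (∫ z, g z ∂μ); let lap : ℝ → (X → ℝ) → (X → ℝ) → ℝ := fun s f g => ∫ t in Set.Ioi (0 : ℝ), Real.exp (-(s * t)) * corr f g t; let e : Fin N → X → ℝ := fun x z => z.2 x ^ 2 / 2 + P.U (z.1 x) + ∑ j : Fin N, ((if j.val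 = x.val + 1 then P.V (z.1 j - z.1 x) / 2 else 0) + (if x.val = j.val + 1 then P.V (z.1 x - z.1 j) / 2 else 0)); let G : ℝ → Matrix (Fin N) (Fin N) ℝ := fun s => Matrix.of fun x y => lap s (e x) (e y); let schur : ℝ → (X → ℝ) → (X → ℝ) → ℝ := fun s f g => lap s f g - ∑ x : Fin N, ∑ y : Fin N, lap s f (e x) * (G s)⁻¹ x y * lap s (e y) g; let J : X → ℝ := fun z => ∑ i : Fin N, P.bondCurrent N i z; ∀ b : Fin N, b.val + 1 < N → ∀ ρ : ℝ, Filter.Tendsto (fun s => schur s (P.bondCurrent N b) J) (nhdsWithin (0 : ℝ) (Set.Ioi 0)) (nhds ρ) → |ρ| ≤ C ∧ (R ≤ b.val → b.val + 2 + R ≤ N → |ρ - k| ≤ ε) := by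
  intro ω₂ lam β γ hω hl hβ hγ T hT
  obtain ⟨C, hC⟩ := hA ω₂ lam β γ hω hl hβ hγ T hT
  obtain ⟨k, hk⟩ := hB ω₂ lam β γ hω hl hβ hγ T hT
  refine ⟨k, C, fun ε hε => ?_⟩
  obtain ⟨R, hR⟩ := hk ε hε
  refine ⟨R, fun N hN => ?_⟩
  intro P X μ corr lap e G schur J b hb ρ hρ
  obtain ⟨hbond, -⟩ := hC N hN
  exact ⟨hbond b hb ρ hρ, fun h1 h2 => hR N hN b h1 h2 ρ hρ⟩

/-- A gives the lead's stub U2 (`stub_uniformContactResponse`) — projection. -/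
theorem uniformContact_of_tight (hA : UniformResponseBound) :
    ∀ ω₂ lam β γ : ℝ, 0 < ω₂ → 0 < lam → 0 < β → 0 < γ → ∀ T : ℝ, 0 < T → ∃ C : ℝ, ∀ N : ℕ, 2 ≤ N → let P := Literature.MathematicalPhysics.KineticTheory.HeatConduction.pinnedChain ω₂ lam β γ; let X := Literature.MathematicalPhysics.KineticTheory.HeatConduction.PhaseSpace N; let μ : MeasureTheory.Measure X := P.gibbsMeasure N T; let corr : (X → ℝ) → (X → ℝ) → ℝ → ℝ := fun f g t => (∫ z, f z * (∫ y, g y ∂(P.transitionKernel N T T t.toNNReal z)) ∂μ) - (∫ z, f z ∂μ) * (∫ z, g z ∂μ); let lap : ℝ → (X → ℝ) → (X → ℝ) → ℝ := fun s f g => ∫ t in Set.Ioi (0 : ℝ), Real.exp (-(s * t)) * corr f g t; let e : Fin N → X → ℝ := fun x z => z.2 x ^ 2 / 2 + P.U (z.1 x) + ∑ j : Fin N, ((if j.val = x.val + 1 then P.V (z.1 j - z.1 x) / 2 else 0) + (if x.val = j.val + 1 then P.V (z.1 x - z.1 j) / 2 else 0)); let G : ℝ → Matrix (Fin N) (Fin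 N) ℝ := fun s => Matrix.of fun x y => lap s (e x) (e y); let schur : ℝ → (X → ℝ) → (X → ℝ) → ℝ := fun s f g => lap s f g - ∑ x : Fin N, ∑ y : Fin N, lap s f (e x) * (G s)⁻¹ x y * lap s (e y) g; let J : X → ℝ := fun z => ∑ i : Fin N, P.bondCurrent N i z; ∀ b : Fin N, (b.val = 0 ∨ b.val = N - 1) → ∀ w : ℝ, Filter.Tendsto (fun s => schur s (fun z => z.2 b ^ 2) J) (nhdsWithin (0 : ℝ) (Set.Ioi 0)) (nhds w) → |w| ≤ C := by
  intro ω₂ lam β γ hω hl hβ hγ T hT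
  obtain ⟨C, hC⟩ := hA ω₂ lam β γ hω hl hβ hγ T hT
  refine ⟨C, fun N hN => ?_⟩
  intro P X μ corr lap e G schur J b hb w hw
  obtain ⟨-, hcontact⟩ := hC N hN
  exact hcontact b hb w hw

/-- **Assembly of the split** (PROVED): `UniformResponseBound → BulkHomogeneity → OrthogonalOhm`, through the landed
reduction `orthogonalOhm_of_uniformResponses` (existence of the limits at each `N` from the landed fixed-`N` facts). -/
theorem orthogonalOhm_of_pieces (hA : UniformResponseBound) (hB : BulkHomogeneity) :
    HonestZwanzig.OrthogonalOhm :=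
  orthogonalOhm_of_uniformResponses (uniformBond_of_pieces hA hB) (uniformContact_of_tight hA)

/-- **The split is exact**: `OrthogonalOhm → UniformResponseBound ∧ BulkHomogeneity` (uniqueness of limits along the
proper filter `𝓝[>] 0`: any limit equals the one the crux provides). -/
theorem pieces_of_orthogonalOhm (h : HonestZwanzig.OrthogonalOhm) : UniformResponseBound ∧ BulkHomogeneity := by
  constructor
  · intro ω₂ lam β γ hω hl hβ hγ T hT
    obtain ⟨k, C, hkC⟩ := h ω₂ lam β γ hω hl hβ hγ T hT
    obtain ⟨R, hR⟩ := hkC 1 one_pos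
    refine ⟨C, fun N hN => ?_⟩
    intro P X μ corr lap e G schur J
    obtain ⟨hbonds, hcontacts⟩ := hR N hN
    refine ⟨fun b hb ρ hρ => ?_, fun b hb w hw => ?_⟩
    · obtain ⟨ρ', hρ', hC', -⟩ := hbonds b hb
      rw [tendsto_nhds_unique hρ hρ']
      exact hC'
    · obtain ⟨w', hw', hC'⟩ := hcontacts b hb
      rw [tendsto_nhds_unique hw hw']
      exact hC'
  · intro ω₂ lam β γ hω hl hβ hγ T hT
    obtain ⟨k, C, hkC⟩ := h ω₂ lam β γ hω hl hβ hγ T hT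
    refine ⟨k, fun ε hε => ?_⟩
    obtain ⟨R, hR⟩ := hkC ε hε
    refine ⟨R, fun N hN => ?_⟩
    intro P X μ corr lap e G schur J b h1 h2 ρ hρ
    obtain ⟨hbonds, -⟩ := hR N hN
    have hb : b.val + 1 < N := by omega
    obtain ⟨ρ', hρ', -, hbulk⟩ := hbonds b hb
    rw [tendsto_nhds_unique hρ hρ']
    exact hbulk h1 h2

/-! ### Piece A alone carries the barrier -/

/-- **Piece A alone caps the Green–Kubo integral**: `UniformResponseBound → ∫₀^∞corr_N(J,J) ≤ C·(N−1)` for all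
`N ≥ 2` (existence of the zero-frequency limits from the landed `stub_G0PosDef` + `stub_fixedNLimits`, then
`stub_upperLimit` and the bound on the `N − 1` genuine bonds). -/
theorem greenKubo_le_of_tight (hA : UniformResponseBound) :
    ∀ ω₂ lam β γ : ℝ, 0 < ω₂ → 0 < lam → 0 < β → 0 < γ → ∀ T : ℝ, 0 < T → ∃ C : ℝ, ∀ N : ℕ, 2 ≤ N → let P := Literature.MathematicalPhysics.KineticTheory.HeatConduction.pinnedChain ω₂ lam β γ; let X := Literature.MathematicalPhysics.KineticTheory.HeatConduction.PhaseSpace N; let μ : MeasureTheory.Measure X := P.gibbsMeasure N T; let corr : (X → ℝ) → (X → ℝ) → ℝ → ℝ := fun f g t => (∫ z, f z * (∫ y, g y ∂(P.transitionKernel N T T t.toNNReal z)) ∂μ) - (∫ z, f z ∂μ) * (∫ z, g z ∂μ); let lap : ℝ → (X → ℝ) → (X → ℝ) → ℝ := fun s f g => ∫ t in Set.Ioi (0 : ℝ), Real.exp (-(s * t)) * corr f g t; let e : Fin N → X → ℝ := fun x z => z.2 x ^ 2 / 2 + P.U (z.1 x) + ∑ j : Fin N, ((if j.val = x.val + 1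 then P.V (z.1 j - z.1 x) / 2 else 0) + (if x.val = j.val + 1 then P.V (z.1 x - z.1 j) / 2 else 0)); let G : ℝ → Matrix (Fin N) (Fin N) ℝ := fun s => Matrix.of fun x y => lap s (e x) (e y); let schur : ℝ → (X → ℝ) → (X → ℝ) → ℝ := fun s f g => lap s f g - ∑ x : Fin N, ∑ y : Fin N, lap s f (e x) * (G s)⁻¹ x y * lap s (e y) g; let J : X → ℝ := fun z => ∑ i : Fin N, P.bondCurrent N i z; (∫ t in Set.Ioi (0 : ℝ), corr J J t) ≤ C * ((N : ℝ) - 1) := by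
  intro ω₂ lam β γ hω hl hβ hγ T hT
  obtain ⟨C, hC⟩ := hA ω₂ lam β γ hω hl hβ hγ T hT
  refine ⟨C, fun N hN => ?_⟩
  intro P X μ corr lap e G schur J
  classical
  have h0 : HonestZwanzig.FeshbachIdentities := HonestZwanzig.stub_feshbachIdentities
  obtain ⟨-, hFI2, -, -⟩ := h0 ω₂ lam β γ hω hl hβ hγ T hT N hN
  -- `G 0` symmetric positive definite ⇒ invertible ⇒ the `s ↓ 0` limits exist (landed fixed-`N` facts)
  have hsymm : ∀ x y, G 0 x y = G 0 y x := fun x y =>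
    pkg_G_symm (ω₂ := ω₂) (lam := lam) (β := β) (γ := γ) (N := N) (T := T)
      (Adm := fun f => Continuous f ∧ ∃ A : ℝ, ∀ z, |f z| ≤ A * Real.exp (P.hamiltonian N z / (8 * T)))
      (corr := corr) (lap := lap) (cov := fun f g => (∫ z, f z * g z ∂μ) - (∫ z, f z ∂μ) * (∫ z, g z ∂μ)) (e := e)
      (fun f => Iff.rfl) (fun s f g => rfl) (fun x z => rfl) hFI2 hω hl.le hβ.le hT 0 x y
  have hpos : ∀ ξ : Fin N → ℝ, ξ ≠ 0 → 0 < ∑ x, ∑ y, ξ x * G 0 x y * ξ y :=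
    stub_G0PosDef ω₂ lam β γ hω hl hβ hγ T hT N hN
  have hPD : (G 0).PosDef := posDef_of_symm_of_pos (G 0) hsymm hpos
  have hdet : IsUnit (G 0).det := isUnit_iff_ne_zero.mpr hPD.det_pos.ne'
  have hlim := stub_fixedNLimits h0 ω₂ lam β γ hω hl hβ hγ T hT N hN hdet
  have hAdmJ : Continuous J ∧ ∃ A : ℝ, ∀ z, |J z| ≤ A * Real.exp (P.hamiltonian N z / (8 * T)) :=
    adm_totalCurrent (fun f => Continuous f ∧ ∃ A : ℝ, ∀ z, |f z| ≤ A * Real.exp (P.hamiltonian N z / (8 * T)))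
      (fun f => Iff.rfl) hω hl.le hβ.le hT
  have hρex : ∀ b : Fin N, Tendsto (fun s => schur s (P.bondCurrent N b) J) (nhdsWithin (0 : ℝ) (Set.Ioi 0))
      (nhds (schur 0 (P.bondCurrent N b) J)) := by
    intro b
    have hAdmj : Continuous (P.bondCurrent N b) ∧
        ∃ A : ℝ, ∀ z, |P.bondCurrent N b z| ≤ A * Real.exp (P.hamiltonian N z / (8 * T)) :=
      adm_bondCurrent (fun f => Continuous f ∧ ∃ A : ℝ, ∀ z, |f z| ≤ A * Real.exp (P.hamiltonian N z / (8 * T)))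
        (fun f => Iff.rfl) hω hl.le hβ.le hT b
    exact hlim _ _ hAdmj hAdmJ
  -- the responses, `0` on the phantom index
  set ρ : Fin N → ℝ := fun b => if b.val + 1 < N then schur 0 (P.bondCurrent N b) J else 0 with hρdef
  have hρt : ∀ b : Fin N, b.val + 1 < N → ρ b = schur 0 (P.bondCurrent N b) J := fun b hb => by
    simp only [hρdef, if_pos hb]
  have hρ0 : ∀ b : Fin N, ¬ b.val + 1 < N → ρ b = 0 := fun b hb => by
    simp only [hρdef, if_neg hb]
  have hup := PositiveMemory.stub_upperLimit h0 ω₂ lam β γ hω hl hβ hγ T hT N hN ρ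
    (fun b hb => by rw [hρt b hb]; exact hρex b) hρ0
  obtain ⟨hbond, -⟩ := hC N hN
  have hρC : ∀ b : Fin N, ρ b ≤ (if b.val + 1 < N then C else 0) := by
    intro b
    by_cases hb : b.val + 1 < N
    · rw [hρt b hb, if_pos hb]
      exact (le_abs_self _).trans (hbond b hb _ (hρex b))
    · rw [hρ0 b hb, if_neg hb]
  have hsum : ∑ b : Fin N, ρ b ≤ C * ((N : ℝ) - 1) := by
    calc ∑ b : Fin N, ρ b ≤ ∑ b : Fin N, (if b.val + 1 < N then C else 0) :=
          Finset.sum_le_sum fun b _ => hρC b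
      _ = C * ((N : ℝ) - 1) := OrthogonalOhmPlacement.sum_ite_bond_eq C (by omega)
  exact hup.trans hsum

/-- **Piece A alone implies the shared open item `BoundedResponse` (stmt-AtomisticToContinuum-10924)** — the
catalogued barrier predicate `HasBoundedResponse (pinnedChain …)` under weak-NESS uniqueness; same closing as
`OrthogonalOhmPlacement.boundedResponse_of_orthogonalOhm`.  So in the split `OrthogonalOhm ⇐ A ∧ B` the tightness
piece is already barrier-strength. -/
theorem boundedResponse_of_tight (hA : UniformResponseBound) : OddSectorIrreversibility.BoundedResponse := by
  refine boundedResponse_of_correctorTheory_of_eventually_le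
    OddSectorIrreversibility.Corrector.CorrectorTheory_proof ?_
  intro ω₂ lam β γ hω hl hβ hγ hU μ hμ T hT D hD
  obtain ⟨C, hC⟩ := greenKubo_le_of_tight hA ω₂ lam β γ hω hl hβ hγ T hT
  refine ⟨C / T ^ 2, Filter.eventually_atTop.2 ⟨2, fun N hN => ?_⟩⟩
  have hGK := (OddSectorIrreversibility.Corrector.openChainGreenKubo_holds ω₂ lam β γ hω hl hβ hγ hU μ hμ T hT N hN).2
  have hpos : (0 : ℝ) < (N : ℝ) - 1 := by
    have : (2 : ℝ) ≤ N := by exact_mod_cast hN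
    linarith
  exact OrthogonalOhmPlacement.div_bound hT hpos (hC N hN) (tendsto_nhds_unique (hD N) hGK)

/-! ### Typed strengthenings and the finite-window transfer statement -/

/-- **S-r1-1 `SchurStieltjesMonotone`.**  Monotonicity of `s ↦ schur_s(j_b, J)` on `(0,∞)` (automatic for a
REVERSIBLE projected generator by the spectral theorem / Stieltjes representation).  Even if true here it transfers
bounds in the wrong direction for this crux: it turns finite-frequency information into LOWER bounds at `s = 0`
(useful for `PositiveMemory`), never into the upper bound U1 needs. -/
def SchurStieltjesMonotone : Prop :=
  ∀ ω₂ lam β γ : ℝ, 0 < ω₂ → 0 < lam → 0 < β → 0 < γ → ∀ T : ℝ, 0 < T → ∀ N : ℕ, 2 ≤ N → let P := Literature.MathematicalPhysics.KineticTheory.HeatConduction.pinnedChain ω₂ lam β γ; let X := Literature.MathematicalPhysics.KineticTheory.HeatConduction.PhaseSpace N; let μ : MeasureTheory.Measure X := P.gibbsMeasure N T; let corr : (X → ℝ) → (X → ℝ) → ℝ → ℝ := fun f g t => (∫ z, f z * (∫ y, g y ∂(P.transitionKernel N T T t.toNNReal z)) ∂μ) - (∫ z, f z ∂μ) * (∫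 z, g z ∂μ); let lap : ℝ → (X → ℝ) → (X → ℝ) → ℝ := fun s f g => ∫ t in Set.Ioi (0 : ℝ), Real.exp (-(s * t)) * corr f g t; let e : Fin N → X → ℝ := fun x z => z.2 x ^ 2 / 2 + P.U (z.1 x) + ∑ j : Fin N, ((if j.val = x.val + 1 then P.V (z.1 j - z.1 x) / 2 else 0) + (if x.val = j.val + 1 then P.V (z.1 x - z.1 j) / 2 else 0)); let G : ℝ → Matrix (Fin N) (Fin N) ℝ := fun s => Matrix.of fun x y => lap s (e x) (e y); let schur : ℝ → (X → ℝ) → (X → ℝ) → ℝ := fun s f g => lap s f g - ∑ x : Fin N, ∑ y : Fin N, lap s f (e x) * (G s)⁻¹ x y * lap s (e y) g; let J : X → ℝ := fun z => ∑ i : Fin N, P.bondCurrent N i z; ∀ b : Fin N, b.val + 1 < N → ∀ s₁ s₂ : ℝ, 0 < s₁ → s₁ ≤ s₂ → schur s₂ (P.bondCurrent N b) J ≤ schur s₁ (P.bondCurrent N b) J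

/-- **S-r1-2 `UniformGeometricModulus`.**  The strengthening an `N`-uniform spectral gap / uniform analyticity disc
of the orthogonal resolvent in the current sector would give: a LINEAR modulus `|schur_{s/2} − schur_s| ≤ C·s`
(`θ = 1` in s2's `UniformSchurModulus`).  Predicted false: pair-field (two-diffuson) modes in `Ran Q` accumulate
rates at `0` and leave a `t^{-3/2}` orthogonal tail, i.e. `θ = 1/2` at best. -/
def UniformGeometricModulus : Prop :=
  ∀ ω₂ lam β γ : ℝ, 0 < ω₂ → 0 < lam → 0 < β → 0 < γ → ∀ T : ℝ, 0 < T → ∃ C s₀ : ℝ, 0 < s₀ ∧ ∀ N : ℕ, 2 ≤ N → let P := Literature.MathematicalPhysics.KineticTheory.HeatConduction.pinnedChain ω₂ lam β γ; let X := Literature.MathematicalPhysics.KineticTheory.HeatConduction.PhaseSpace N; let μ : MeasureTheory.Measure X := P.gibbsMeasure N T; let corr : (X → ℝ) → (X → ℝ) → ℝ → ℝ := fun f g t => (∫ z, f z * (∫ y, g y ∂(P.transitionKernel N T T t.toNNReal z)) ∂μ) - (∫ z, f z ∂μ) * (∫ z, g z ∂μ); let lap : ℝ → (X → ℝ) → (X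 → ℝ) → ℝ := fun s f g => ∫ t in Set.Ioi (0 : ℝ), Real.exp (-(s * t)) * corr f g t; let e : Fin N → X → ℝ := fun x z => z.2 x ^ 2 / 2 + P.U (z.1 x) + ∑ j : Fin N, ((if j.val = x.val + 1 then P.V (z.1 j - z.1 x) / 2 else 0) + (if x.val = j.val + 1 then P.V (z.1 x - z.1 j) / 2 else 0)); let G : ℝ → Matrix (Fin N) (Fin N) ℝ := fun s => Matrix.of fun x y => lap s (e x) (e y); let schur : ℝ → (X → ℝ) → (X → ℝ) → ℝ := fun s f g => lap s f g - ∑ x : Fin N, ∑ y : Fin N, lap s f (e x) * (G s)⁻¹ x y * lap s (e y) g; let J : X → ℝ := fun z => ∑ i : Fin N, P.bondCurrent N i z; ∀ b : Fin N, b.val + 1 < N → ∀ s : ℝ, 0 < s → s ≤ s₀ → |schur (s / 2) (P.bondCurrent N b) J - schur s (P.bondCurrent N b) J| ≤ C * s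

/-- **T-r1-5 / D-r1-3 `FiniteWindowOhm`.**  For every finite time window `τ` the UNprojected window responses
`∫₀^τ corr(j_b, J)` are `N`-uniformly bounded and bulk-homogeneous — the statement that finite speed of
propagation (Marchioro–Pellegrinotti–Pulvirenti 1978; Buttà–Caglioti–Di Ruzza–Marchioro 2007) plus the fixed-`N`
package should give (size M/L).  It is the part of the crux WITHOUT `HasBoundedResponse` content; the complement
(the `N`-uniform tail `∫_τ^∞`) is the whole crux. -/
def FiniteWindowOhm : Prop :=
  ∀ ω₂ lam β γ : ℝ, 0 < ω₂ → 0 < lam → 0 < β → 0 < γ → ∀ T : ℝ, 0 < T → ∀ τ : ℝ, 0 < τ → ∃ k C : ℝ, ∀ ε : ℝ, 0 < ε → ∃ R : ℕ, ∀ N : ℕ, 2 ≤ N → let P := Literature.MathematicalPhysics.KineticTheory.HeatConduction.pinnedChain ω₂ lam β γ; let X := Literature.MathematicalPhysics.KineticTheory.HeatConduction.PhaseSpace N; let μ : MeasureTheory.Measure X := P.gibbsMeasure N T; let corr : (X → ℝ) → (X → ℝ) → ℝ → ℝ := fun f g t => (∫ z, f z * (∫ y, g y ∂(P.transitionKernel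 N T T t.toNNReal z)) ∂μ) - (∫ z, f z ∂μ) * (∫ z, g z ∂μ); let lap : ℝ → (X → ℝ) → (X → ℝ) → ℝ := fun s f g => ∫ t in Set.Ioi (0 : ℝ), Real.exp (-(s * t)) * corr f g t; let e : Fin N → X → ℝ := fun x z => z.2 x ^ 2 / 2 + P.U (z.1 x) + ∑ j : Fin N, ((if j.val = x.val + 1 then P.V (z.1 j - z.1 x) / 2 else 0) + (if x.val = j.val + 1 then P.V (z.1 x - z.1 j) / 2 else 0)); let G : ℝ → Matrix (Fin N) (Fin N) ℝ := fun s => Matrix.of fun x y => lap s (e x) (e y); let schur : ℝ → (X → ℝ) → (X → ℝ) → ℝ := fun s f g => lap s f g - ∑ x : Fin N, ∑ y : Fin N, lap s f (e x) * (G s)⁻¹ x y * lap s (e y) g; let J : X → ℝ := fun z => ∑ i : Fin N, P.bondCurrent N i z; ∀ b : Fin N, b.val + 1 < N → |∫ t in Set.Ioc (0 : ℝ) τ, corr (P.bondCurrent N b) J t| ≤ C ∧ (R ≤ b.val → b.val + 2 + R ≤ N → |(∫ t in Set.Ioc (0 : ℝ) τ, corr (P.bondCurrent N b) J t) - k| ≤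 ε)

end Summit.AtomisticToContinuum.FouriersLaw.Cruxes.OrthogonalOhm.StrategyCensusR1

end
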